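import Literature.Computability.Complexity.Randomized
import HarnessLib

/-!
# Counting coin strings: an integer API for `uniformProb` (trunk CplxCore)

`uniformProb m E = #(E ∩ {0,1}^m) / 2^m` (`Randomized.lean`) is a real number; the operator classes
`pMajority`, `bp`, `rp` compare it with `1/2`, `2/3`. This file exposes the numerator
`cnt m E = #(E ∩ {0,1}^m)` and the arithmetic facts used in counting arguments (Gill 1977, §5;
Arora–Barak 2009, §7.1), all PROVED:

* `uniformProb_eq_cnt_div`, `cnt_le`, `half_lt_uniformProb_iff` (`Pr > 1/2 ↔ 2^m < 2·cnt`),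
  `le_uniformProb_iff_of_pos`-style bridges are left to users via `uniformProb_eq_cnt_div`;
* `cnt_congr`, `cnt_univ`, `cnt_eq_two_pow_of_forall`, `cnt_add_cnt_compl`, `cnt_pos_iff`,
  `cnt_zero`, `cnt_succ` (split on the first coin), `cnt_noFalse` (one all-ones string per length),
  `uniformProb_compl` (`Pr[Eᶜ] = 1 - Pr[E]`).

## References

* J. Gill, *Computational complexity of probabilistic Turing machines*, SIAM J. Comput. 6 (1977), §5.
* S. Arora, B. Barak, *Computational Complexity: A Modern Approach*, CUP 2009, §7.1.
-/

namespace Literature.Computability.Complexity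

open _root_.Computability

/-! ### Counting coin strings -/

/-- `cnt m E`: the number of bit strings of length `m` in `E` (the numerator of `uniformProb m E`).
[Arora–Barak 2009, §7.1] [folklore] -/
noncomputable def cnt (m : ℕ) (E : Set (List Bool)) : ℕ :=
  open scoped Classical in
  (Finset.univ.filter fun r : List.Vector Bool m => r.toList ∈ E).card

/-- `uniformProb m E = cnt m E / 2^m` (definitional). [Arora–Barak 2009, §7.1] [folklore] -/
theorem uniformProb_eq_cnt_div (m : ℕ) (E : Set (List Bool)) :
    uniformProb m E = (cnt m E : ℝ) / 2 ^ m :=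
  rfl

/-- `cnt m E ≤ 2^m`. [folklore] -/
theorem cnt_le (m : ℕ) (E : Set (List Bool)) : cnt m E ≤ 2 ^ m := by
  classical
  unfold cnt
  have h := Finset.card_filter_le (Finset.univ : Finset (List.Vector Bool m))
    (fun r => r.toList ∈ E)
  rwa [Finset.card_univ, card_vector, Fintype.card_bool] at h

/-- **Strict majority as an integer inequality**: `1/2 < uniformProb m E ↔ 2^m < 2 · cnt m E`.
[Gill 1977, Def. 5.1] [folklore] -/
theorem half_lt_uniformProb_iff (m : ℕ) (E : Set (List Bool)) :
    1 / 2 < uniformProb m E ↔ 2 ^ m < 2 * cnt m E := by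
  rw [uniformProb_eq_cnt_div, lt_div_iff₀ (by positivity)]
  constructor
  · intro h
    have h' : ((2 ^ m : ℕ) : ℝ) < ((2 * cnt m E : ℕ) : ℝ) := by push_cast; linarith
    exact_mod_cast h'
  · intro h
    have h' : ((2 ^ m : ℕ) : ℝ) < ((2 * cnt m E : ℕ) : ℝ) := by exact_mod_cast h
    push_cast at h'
    linarith

/-- `cnt` only depends on the strings of length `m` in the event. [folklore] -/
theorem cnt_congr {m : ℕ} {E E' : Set (List Bool)}
    (h : ∀ y : List Bool, y.length = m → (y ∈ E ↔ y ∈ E')) : cnt m E = cnt m E' := by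
  classical
  unfold cnt
  congr 1
  exact Finset.filter_congr fun r _ => h r.toList r.toList_length

/-- The sure event: `cnt m univ = 2^m`. [folklore] -/
theorem cnt_univ (m : ℕ) : cnt m Set.univ = 2 ^ m := by
  classical
  unfold cnt
  simp [card_vector]

/-- An event containing every string of length `m` has `cnt = 2^m`. [folklore] -/
theorem cnt_eq_two_pow_of_forall {m : ℕ} {E : Set (List Bool)} (h : ∀ y : List Bool, y.length = m → y ∈ E) :
    cnt m E = 2 ^ m := by
  rw [← cnt_univ m]
  exact cnt_congr fun y hy => by simp [h y hy]

/-- Complement rule: `cnt m E + cnt m Eᶜ = 2^m`. [folklore] -/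
theorem cnt_add_cnt_compl (m : ℕ) (E : Set (List Bool)) : cnt m E + cnt m Eᶜ = 2 ^ m := by
  classical
  unfold cnt
  have h := Finset.card_filter_add_card_filter_not (s := (Finset.univ : Finset (List.Vector Bool m)))
    (fun r : List.Vector Bool m => r.toList ∈ E)
  rw [Finset.card_univ, card_vector, Fintype.card_bool] at h
  simpa using h

/-- `cnt` is positive iff the event contains a string of length `m`. [folklore] -/
theorem cnt_pos_iff (m : ℕ) (E : Set (List Bool)) :
    0 < cnt m E ↔ ∃ y : List Bool, y.length = m ∧ y ∈ E := by
  classical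
  unfold cnt
  rw [Finset.card_pos]
  constructor
  · rintro ⟨r, hr⟩
    simp only [Finset.mem_filter, Finset.mem_univ, true_and] at hr
    exact ⟨r.toList, r.toList_length, hr⟩
  · rintro ⟨y, hy, hyE⟩
    exact ⟨⟨y, hy⟩, by simpa using hyE⟩

/-- No coins: `cnt 0 E = 1` if `[] ∈ E`, else `0`. [folklore] -/
theorem cnt_zero (E : Set (List Bool)) [Decidable ([] ∈ E)] : cnt 0 E = if [] ∈ E then 1 else 0 := by
  classical
  unfold cnt
  have huniv : (Finset.univ : Finset (List.Vector Bool 0)) = {List.Vector.nil} := by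
    ext v
    simp [eq_iff_true_of_subsingleton]
  rw [huniv, Finset.filter_singleton]
  split_ifs with h <;> simp_all

/-- **Splitting on the first coin**: `cnt (m+1) E = cnt m {y | 0y ∈ E} + cnt m {y | 1y ∈ E}`. [folklore] -/
theorem cnt_succ (m : ℕ) (E : Set (List Bool)) :
    cnt (m + 1) E = cnt m {y | false :: y ∈ E} + cnt m {y | true :: y ∈ E} := by
  classical
  let e : Bool × List.Vector Bool m ≃ List.Vector Bool (m + 1) :=
    { toFun := fun p => p.1 ::ᵥ p.2
      invFun := fun v => (v.head, v.tail)
      left_inv := fun p => by simp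
      right_inv := fun v => List.Vector.cons_head_tail v }
  rw [add_comm (cnt m {y | false :: y ∈ E})]
  unfold cnt
  rw [Finset.card_filter, Finset.card_filter, Finset.card_filter,
    ← Fintype.sum_equiv e _ (fun v => if v.toList ∈ E then 1 else 0) (fun _ => rfl),
    Fintype.sum_prod_type, Fintype.sum_bool]
  simp only [e, Equiv.coe_fn_mk, List.Vector.toList_cons, Set.mem_setOf_eq]
  congr 1

/-- Exactly one string of each length has no `0` (the all-ones string). [folklore] -/
theorem cnt_noFalse (m : ℕ) : cnt m {y | false ∉ y} = 1 := by
  induction m with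
  | zero => rw [cnt_zero]; simp
  | succ m ih =>
    rw [cnt_succ]
    have h0 : cnt m {y : List Bool | false :: y ∈ {y : List Bool | false ∉ y}} = 0 := by
      have := (cnt_pos_iff m {y : List Bool | false :: y ∈ {y : List Bool | false ∉ y}}).not
      simp only [not_lt, Nat.le_zero] at this
      exact this.2 (by simp)
    have h1 : cnt m {y : List Bool | true :: y ∈ {y : List Bool | false ∉ y}} = cnt m {y | false ∉ y} :=
      cnt_congr fun y _ => by simp
    rw [h0, h1, ih]

/-- Complement rule for the counting probability: `Pr[Eᶜ] = 1 - Pr[E]` (the same statement is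
proved as `Literature.Computability.QuantumComplexity.uniformProb_compl` in `QuantumComplexity/BQPProofs.lean`, which does
not belong below the trunk `CplxCore`). [Arora–Barak 2009, §7.1] [folklore] -/
theorem uniformProb_compl (m : ℕ) (E : Set (List Bool)) :
    uniformProb m Eᶜ = 1 - uniformProb m E := by
  rw [uniformProb_eq_cnt_div, uniformProb_eq_cnt_div, eq_sub_iff_add_eq, ← add_div, add_comm]
  have h := cnt_add_cnt_compl m E
  rw [div_eq_one_iff_eq (by positivity)]
  exact_mod_cast h

end Literature.Computability.Complexity
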